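import Literature.MathematicalPhysics.QuantumLattice.TrilayerHubbardTTPrimeInequivalentPlanes
import Literature.MathematicalPhysics.QuantumLattice.SuperlatticeCellFillingConvexity
import HarnessLib

/-!
# Trilayer `t–t'` Hubbard crystals: the inner and outer planes share ONE chemical potential — doping-split brackets
# from the planes' 2D grand potentials with no ensemble slack

Topic `Literature/MathematicalPhysics/QuantumLattice` (namespace = path; family `hubbard`). The `d = 2`, period-3 instance of
`SuperlatticeCellFillingConvexity` §3 in the vocabulary of `TrilayerHubbardTTPrimeInequivalentPlanes` (`gcEnergyDensityTT'`): for the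
trilayer crystal `trilayerHubbardTTPrimeViews t t' U ε t⊥ t⊥'` (`U_j ≥ 0`) and a periodic state `ω` within `δ` of the infimum at
its own cell filling `ρ̄ ∈ (0, 2)`, there is ONE chemical potential `μ` (a supporting slope of the crystal's convex energy–filling
curve — electrochemical equilibrium between the planes, Mukuda et al. 2012 §2) such that, with `ν_j = μ − ε_j`,
`Δ = 3δ + 2(2|t⊥| + |t⊥'|)` and `p_j = gcEnergyDensityTT' t_j t'_j U_j`, every plane `j` and every `h > 0` satisfy
`(p_j(ν_j − h) − p_j(ν_j) − Δ)/h ≤ n_j ≤ (p_j(ν_j) − p_j(ν_j + h) + Δ)/h`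
(`trilayer_exists_common_chemicalPotential_layerDensity_brackets`), and every plane marginal is a near grand-canonical ground
state of its own plane at `ν_j`: `e_{Φ_j}(σ_j) − ν_j n_j ≤ p_j(ν_j) + Δ` (`trilayer_exists_common_chemicalPotential`).

Everything is PROVED; no definition, no named fact, no number. HONEST SCOPE: `μ` is produced non-constructively; the bracket
functions are monotone in `μ`, so a consumer evaluates them on a certified `μ`-interval (secants of the crystal's energy words);
energies and densities only, `T = 0`, nothing here is a phase word.

## References

* D. Ruelle, *Statistical Mechanics: Rigorous Results* (1969), §3.4. [cite: Ruelle1969, §3.4]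
* H. Mukuda, S. Shimizu, A. Iyo, Y. Kitaoka, J. Phys. Soc. Jpn. 81 (2012) 011008, §2. [cite: MukudaEtAl2012, §2]
* Koma–Tasaki (1994) §1 (tangent brackets). [cite: KomaTasaki1994, §1]
-/

noncomputable section

namespace Literature.MathematicalPhysics.QuantumLattice

open Matrix Finset HubbardWave0 Literature.Probability.LatticeModels ThermodynamicLimit
open scoped ComplexOrder BigOperators

/-- **ONE CHEMICAL POTENTIAL FOR THE THREE PLANES** (`U_j ≥ 0`, cell filling in `(0,2)`): for a periodic state within `δ` of the
infimum at its own cell filling there is `μ` with `e_{Φ(t_j,t'_j,U_j)}(σ_j) − (μ − ε_j) n_j ≤ gcEnergyDensityTT' t_j t'_j U_j (μ − ε_j)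
+ 3δ + 2(2|t⊥| + |t⊥'|)` for every plane `j`. [cite: Ruelle1969, §3.4] -/
theorem trilayer_exists_common_chemicalPotential {ω : InfVolFermionState 3} (hω : ω.IsPeriodic (stackPeriods 2 2))
    (t t' ε : Fin 3 → ℝ) {U : Fin 3 → ℝ} (hU : ∀ j, 0 ≤ U j) (tperp tperp' : ℝ) {δ : ℝ}
    (hδ : ω.cellEnergy (trilayerHubbardTTPrimeViews t t' U ε tperp tperp') 1 ≤
      infCellEnergyOn (periodicStatesAt (stackPeriods 2 2) (ω.cellFilling (stackPeriods 2 2)))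
        (trilayerHubbardTTPrimeViews t t' U ε tperp tperp') 1 + δ)
    (hρ0 : 0 < ω.cellFilling (stackPeriods 2 2)) (hρ2 : ω.cellFilling (stackPeriods 2 2) < 2) :
    ∃ μ : ℝ, ∀ j : Fin 3,
      (ω.layerMarginal (layerCoset 2 j)).meanEnergy (hubbardTTPrimeFermionInteraction (t j) (t' j) (U j)) 1 -
          (μ - ε j) * (ω.layerMarginal (layerCoset 2 j)).density ≤
        gcEnergyDensityTT' (t j) (t' j) (U j) (μ - ε j) + (3 * δ + 2 * (2 * |tperp| + |tperp'|)) := by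
  have hint := Ioo_subset_interior_setOf_periodicStatesAt_nonempty 2 ⟨hρ0, hρ2⟩
  obtain ⟨μ, hμ⟩ := hω.exists_common_chemicalPotential 2 two_pos ε U ttPrimeVec_ne_zero (fun j => ttPrimeAmp (t j) (t' j))
    (w := fun _ : Fin 1 => (unitVec (0 : Fin 3) : Site 3)) (fun _ => unitVec_zero_apply_zero_ne_zero) (trilayerTz tperp tperp')
    le_rfl le_rfl ttPrimeVec_mem_thicken_one (fun _ => unitVec_mem_thicken_one 0) hδ hint
  refine ⟨μ, fun j => ?_⟩
  have h := hμ j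
  rw [pencil_ttPrime_eq_hubbardTTPrimeMu, neg_sub, tiGroundEnergyDensity_hubbardTTPrimeMu_eq_gcEnergyDensityTT' _ _ (hU j),
    InfVolFermionState.meanEnergy_hubbardTTPrimeMu, two_mul_sum_abs_trilayerTz, trilayer_card] at h
  exact h

/-- **INNER/OUTER DOPING-SPLIT BRACKETS AT THE COMMON CHEMICAL POTENTIAL** (`U_j ≥ 0`, cell filling in `(0,2)`): there is `μ`
such that, with `ν_j = μ − ε_j`, `Δ = 3δ + 2(2|t⊥| + |t⊥'|)`, `p_j = gcEnergyDensityTT' t_j t'_j U_j`, every plane `j` and every `h > 0`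
satisfy `(p_j(ν_j − h) − p_j(ν_j) − Δ)/h ≤ n_j ≤ (p_j(ν_j) − p_j(ν_j + h) + Δ)/h`. [cite: KomaTasaki1994, §1] -/
theorem trilayer_exists_common_chemicalPotential_layerDensity_brackets {ω : InfVolFermionState 3}
    (hω : ω.IsPeriodic (stackPeriods 2 2)) (t t' ε : Fin 3 → ℝ) {U : Fin 3 → ℝ} (hU : ∀ j, 0 ≤ U j)
    (tperp tperp' : ℝ) {δ : ℝ}
    (hδ : ω.cellEnergy (trilayerHubbardTTPrimeViews t t' U ε tperp tperp') 1 ≤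
      infCellEnergyOn (periodicStatesAt (stackPeriods 2 2) (ω.cellFilling (stackPeriods 2 2)))
        (trilayerHubbardTTPrimeViews t t' U ε tperp tperp') 1 + δ)
    (hρ0 : 0 < ω.cellFilling (stackPeriods 2 2)) (hρ2 : ω.cellFilling (stackPeriods 2 2) < 2) :
    ∃ μ : ℝ, ∀ (j : Fin 3) (h : ℝ), 0 < h →
      (gcEnergyDensityTT' (t j) (t' j) (U j) (μ - ε j - h) - gcEnergyDensityTT' (t j) (t' j) (U j) (μ - ε j) -
          (3 * δ + 2 * (2 * |tperp| + |tperp'|))) / h ≤ (ω.layerMarginal (layerCoset 2 j)).density ∧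
      (ω.layerMarginal (layerCoset 2 j)).density ≤
        (gcEnergyDensityTT' (t j) (t' j) (U j) (μ - ε j) - gcEnergyDensityTT' (t j) (t' j) (U j) (μ - ε j + h) +
          (3 * δ + 2 * (2 * |tperp| + |tperp'|))) / h := by
  have hint := Ioo_subset_interior_setOf_periodicStatesAt_nonempty 2 ⟨hρ0, hρ2⟩
  obtain ⟨μ, hμ⟩ := hω.exists_common_chemicalPotential_layerDensity_brackets 2 two_pos ε U ttPrimeVec_ne_zero
    (fun j => ttPrimeAmp (t j) (t' j)) (w := fun _ : Fin 1 => (unitVec (0 : Fin 3) : Site 3))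
    (fun _ => unitVec_zero_apply_zero_ne_zero) (trilayerTz tperp tperp') le_rfl le_rfl ttPrimeVec_mem_thicken_one
    (fun _ => unitVec_mem_thicken_one 0) hδ hint
  refine ⟨μ, fun j h hh => ?_⟩
  have hb := hμ j h hh
  simp only [pencil_ttPrime_eq_hubbardTTPrimeMu, tiGroundEnergyDensity_hubbardTTPrimeMu_eq_gcEnergyDensityTT' _ _ (hU _),
    two_mul_sum_abs_trilayerTz, trilayer_card] at hb
  have e1 : -(ε j - μ + h) = μ - ε j - h := by ring
  have e2 : -(ε j - μ) = μ - ε j := by ring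
  have e3 : -(ε j - μ - h) = μ - ε j + h := by ring
  rw [e1, e2, e3] at hb
  exact hb

end Literature.MathematicalPhysics.QuantumLattice
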